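import Literature.MathematicalPhysics.KineticTheory.HardSphereWindowPressureStatic
import Summits.AtomisticToContinuum.HydrodynamicLimit.Theorems.BoltzmannGreenKubo.Negative.JointMeasurability
import Summits.AtomisticToContinuum.HydrodynamicLimit.Theorems.AntiMazurCoboundariesKineticWindowGronwallWindowSubadditivity
import HarnessLib

/-!
# Splitting a window exponential moment over the rank of a product decomposition
# (helper file 2 of 3 toward stub `stub_productKineticInstance`, line `rare-band-ladder-dock`,
# crux `KineticWindowGronwall`, stmt-AtomisticToContinuum-9282)

Support file (`--supports stmt-AtomisticToContinuum-9282`) for the registered stub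
`stub_productKineticInstance : ProductKineticInstance` of the lead's skeleton
`Cruxes/KineticWindowGronwall/Lines/rare_band_ladder_dock.lean` (§1b). KC1's class member `lo` is, in the
thermal frame, `β · lo = n⁻¹ Σₘ qₘ` — a finite AVERAGE of `n = 12` one-body product observables `qₘ`, each of
which the product node of the line bounds in window exponential moment. This file turns the `n` single bounds
into the bound for `β · lo`, for an ARBITRARY hard-sphere flow `Φ` on `𝕋³` and any law `P` carried by its good
set:

* §1 `lintegral_exp_le_of_eq_avg` — ARITHMETIC-MEAN JENSEN for exponential moments: if `Y = n⁻¹ Σₘ Xₘ` a.e.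
  with each `Xₘ` a.e.-measurable and `∫⁻ e^{Xₘ} dP ≤ B`, then `∫⁻ e^{Y} dP ≤ B` (convexity of `exp`,
  `ConvexOn.map_sum_le`; linearity of `lintegral` over a.e.-measurable summands);
* §2 `windowSum_split` — LINEARITY OF THE WINDOW FUNCTIONAL ON GOOD ORBITS: for continuous one-body `qₘ` and
  `β q = c Σₘ qₘ` pointwise, `β Σᵢ w⁻¹∫₀ʷ q(Φ_r z i) dr = c Σₘ Σᵢ w⁻¹∫₀ʷ qₘ(Φ_r z i) dr` for every GOOD `z`
  (continuous observables are interval integrable along good orbits — bounded speeds by energy conservation,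
  Literature `HardSphereFlow.intervalIntegrable_comp_flow_of_continuous`);
* §3 `aemeasurable_windowSum` — the window functional `z ↦ Σᵢ w⁻¹∫₀ʷ q(Φ_r z i) dr` of a continuous one-body
  `q` is `P`-a.e. measurable when `P(goodᶜ) = 0` (jointly measurable modification of the flow off the good
  set, `BoltzmannGreenKuboOrthMomentum.flowMod`, and the landed bridge
  `KineticWindowGronwallWindowSubadditivity.aemeasurable_window_of_modification`);
* §4 `lintegral_exp_window_avg_le` — the three combined: the registered helper statement `WindowRankSplit`.
-/

noncomputable section

namespace Summit.AtomisticToContinuum.HydrodynamicLimit.Theorems.KineticWindowGronwallProductKineticInstance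

open MeasureTheory Set Filter
open scoped ENNReal BigOperators
open Literature.Analysis.FluidPDE Literature.MathematicalPhysics.KineticTheory

/-! ## §1 Arithmetic-mean Jensen for exponential moments -/

/-- **Arithmetic-mean Jensen for exponential moments.** If `Y = (card ι)⁻¹ Σₘ Xₘ` almost everywhere, each `Xₘ`
is a.e.-measurable and `∫⁻ e^{Xₘ} dP ≤ B` for every `m`, then `∫⁻ e^{Y} dP ≤ B`
(`exp(n⁻¹ Σ Xₘ) ≤ n⁻¹ Σ exp Xₘ` pointwise). [folklore] -/
theorem lintegral_exp_le_of_eq_avg {Ω : Type*} [MeasurableSpace Ω] {P : Measure Ω} {ι : Type*}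
    [Fintype ι] [Nonempty ι] {Y : Ω → ℝ} {X : ι → Ω → ℝ} (hX : ∀ m, AEMeasurable (X m) P)
    (hY : ∀ᵐ z ∂P, Y z = (Fintype.card ι : ℝ)⁻¹ * ∑ m, X m z) {B : ℝ≥0∞}
    (hB : ∀ m, ∫⁻ z, ENNReal.ofReal (Real.exp (X m z)) ∂P ≤ B) :
    ∫⁻ z, ENNReal.ofReal (Real.exp (Y z)) ∂P ≤ B := by
  set n : ℝ := (Fintype.card ι : ℝ) with hn
  have hn0 : 0 < n := by rw [hn]; exact_mod_cast Fintype.card_pos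
  -- pointwise Jensen for the convex `exp` with equal weights `n⁻¹`
  have hJ : ∀ z, Real.exp (n⁻¹ * ∑ m, X m z) ≤ ∑ m, n⁻¹ * Real.exp (X m z) := by
    intro z
    have h1 : ∑ _m : ι, n⁻¹ = 1 := by
      rw [Finset.sum_const, Finset.card_univ, nsmul_eq_mul, ← hn, mul_inv_cancel₀ hn0.ne']
    have h := (convexOn_exp).map_sum_le (t := Finset.univ) (w := fun _ : ι => n⁻¹)
      (p := fun m => X m z) (fun _ _ => inv_nonneg.2 hn0.le) h1 (fun _ _ => Set.mem_univ _)
    simpa only [smul_eq_mul, Finset.mul_sum] using h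
  have hmeas : ∀ m, AEMeasurable (fun z => ENNReal.ofReal n⁻¹ * ENNReal.ofReal (Real.exp (X m z))) P :=
    fun m => ((Real.measurable_exp.comp_aemeasurable (hX m)).ennreal_ofReal).const_mul _
  calc ∫⁻ z, ENNReal.ofReal (Real.exp (Y z)) ∂P
      ≤ ∫⁻ z, ∑ m, ENNReal.ofReal n⁻¹ * ENNReal.ofReal (Real.exp (X m z)) ∂P := by
        refine lintegral_mono_ae ?_
        filter_upwards [hY] with z hz
        rw [hz]
        refine (ENNReal.ofReal_le_ofReal (hJ z)).trans_eq ?_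
        rw [ENNReal.ofReal_sum_of_nonneg fun m _ => by positivity]
        exact Finset.sum_congr rfl fun m _ => ENNReal.ofReal_mul (inv_nonneg.2 hn0.le)
    _ = ∑ m, ENNReal.ofReal n⁻¹ * ∫⁻ z, ENNReal.ofReal (Real.exp (X m z)) ∂P := by
        rw [lintegral_finsetSum' _ fun m _ => hmeas m]
        exact Finset.sum_congr rfl fun m _ => lintegral_const_mul' _ _ ENNReal.ofReal_ne_top
    _ ≤ ∑ _m : ι, ENNReal.ofReal n⁻¹ * B := Finset.sum_le_sum fun m _ => mul_le_mul' le_rfl (hB m)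
    _ = B := by
        rw [Finset.sum_const, Finset.card_univ, nsmul_eq_mul, ← mul_assoc, ← ENNReal.ofReal_natCast,
          ← hn, ← ENNReal.ofReal_mul hn0.le, mul_inv_cancel₀ hn0.ne', ENNReal.ofReal_one, one_mul]

/-! ## §2 Linearity of the window functional on good orbits -/

section Flow

variable {n : ℕ} {ε : ℝ} (Φ : HardSphereFlow (Torus.geometry (Fin 3)) ε n)

/-- **Splitting the window functional over the rank, on a good orbit.** For continuous one-body observables
`qₘ` with `β q = c Σₘ qₘ` pointwise and a GOOD datum `z`:
`β Σᵢ w⁻¹∫₀ʷ q(Φ_r z i) dr = c Σₘ Σᵢ w⁻¹∫₀ʷ qₘ(Φ_r z i) dr` (each `r ↦ qₘ(Φ_r z i)` is interval integrable).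
[folklore] -/
theorem windowSum_split {z : Config n (Fin 3) T3} (hz : z ∈ Φ.good) {ι : Type*} [Fintype ι]
    (q : T3 × V3 → ℝ) {qm : ι → T3 × V3 → ℝ} (hqm : ∀ m, Continuous (qm m)) (β c w : ℝ)
    (hq : ∀ y, β * q y = c * ∑ m, qm m y) :
    β * ∑ i, w⁻¹ * ∫ r in (0 : ℝ)..w, q (Φ.flow r z i) =
      c * ∑ m, ∑ i, w⁻¹ * ∫ r in (0 : ℝ)..w, qm m (Φ.flow r z i) := by
  have hint : ∀ m i, IntervalIntegrable (fun r => qm m (Φ.flow r z i)) volume 0 w := fun m i =>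
    Φ.intervalIntegrable_comp_flow_of_continuous hz ((hqm m).comp (continuous_apply i)) 0 w
  have hi : ∀ i, β * (w⁻¹ * ∫ r in (0 : ℝ)..w, q (Φ.flow r z i)) =
      c * ∑ m, w⁻¹ * ∫ r in (0 : ℝ)..w, qm m (Φ.flow r z i) := by
    intro i
    calc β * (w⁻¹ * ∫ r in (0 : ℝ)..w, q (Φ.flow r z i))
        = w⁻¹ * ∫ r in (0 : ℝ)..w, β * q (Φ.flow r z i) := by
          rw [intervalIntegral.integral_const_mul]; ring
      _ = w⁻¹ * ∫ r in (0 : ℝ)..w, c * ∑ m, qm m (Φ.flow r z i) := by simp_rw [hq]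
      _ = w⁻¹ * (c * ∑ m, ∫ r in (0 : ℝ)..w, qm m (Φ.flow r z i)) := by
          rw [intervalIntegral.integral_const_mul, intervalIntegral.integral_finsetSum fun m _ => hint m i]
      _ = c * ∑ m, w⁻¹ * ∫ r in (0 : ℝ)..w, qm m (Φ.flow r z i) := by
          rw [Finset.mul_sum, Finset.mul_sum, Finset.mul_sum]
          exact Finset.sum_congr rfl fun m _ => by ring
  rw [Finset.mul_sum, Finset.sum_congr rfl fun i _ => hi i, ← Finset.mul_sum, Finset.sum_comm]

/-! ## §3 a.e.-measurability of window functionals -/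

/-- **The window functional of a continuous one-body observable is a.e. measurable** under any law carried by
the good set: `z ↦ Σᵢ w⁻¹∫₀ʷ q(Φ_r z i) dr` is `P`-a.e. measurable when `P(goodᶜ) = 0` (the flow modified off
the good set, `BoltzmannGreenKuboOrthMomentum.flowMod`, is jointly measurable and agrees with the flow along good
orbits; bridge `KineticWindowGronwallWindowSubadditivity.aemeasurable_window_of_modification`). [folklore] -/
theorem aemeasurable_windowSum {P : Measure (Config n (Fin 3) T3)} (hP : P Φ.goodᶜ = 0)
    {q : T3 × V3 → ℝ} (hq : Continuous q) (w : ℝ) :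
    AEMeasurable (fun z => ∑ i, w⁻¹ * ∫ r in (0 : ℝ)..w, q (Φ.flow r z i)) P := by
  refine Finset.aemeasurable_fun_sum _ fun i _ => AEMeasurable.const_mul ?_ _
  have hF : Measurable fun z : Config n (Fin 3) T3 => q (z i) := (hq.comp (continuous_apply i)).measurable
  exact KineticWindowGronwallWindowSubadditivity.aemeasurable_window_of_modification Φ P hP
    (fun z => q (z i)) (g := fun s z => q ((BoltzmannGreenKuboOrthMomentum.flowMod Φ (s, z)) i))
    (hF.comp (BoltzmannGreenKuboOrthMomentum.measurable_flowMod Φ))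
    (fun z hz s => by simp only [BoltzmannGreenKuboOrthMomentum.flowMod_of_mem Φ hz]) 0 w

/-! ## §4 The window exponential moment of an average of one-body products -/

/-- **THE RANK SPLIT.** For a hard-sphere flow `Φ` on `𝕋³`, a law `P` with `P(goodᶜ) = 0`, continuous one-body
observables `qₘ` indexed by a nonempty finite type and `β q = (card)⁻¹ Σₘ qₘ` pointwise: if every single window
exponential moment `∫⁻ exp(Σᵢ w⁻¹∫₀ʷ qₘ(Φ_r z i) dr) dP` is `≤ B`, so is `∫⁻ exp(β Σᵢ w⁻¹∫₀ʷ q(Φ_r z i) dr) dP`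
(split on good orbits, arithmetic-mean Jensen, a.e.-measurability of the summands). [folklore] -/
theorem lintegral_exp_window_avg_le {P : Measure (Config n (Fin 3) T3)} (hP : P Φ.goodᶜ = 0)
    {ι : Type*} [Fintype ι] [Nonempty ι] (q : T3 × V3 → ℝ) {qm : ι → T3 × V3 → ℝ}
    (hqm : ∀ m, Continuous (qm m)) (β : ℝ) (hq : ∀ y, β * q y = (Fintype.card ι : ℝ)⁻¹ * ∑ m, qm m y)
    (w : ℝ) {B : ℝ≥0∞}
    (hB : ∀ m, ∫⁻ z, ENNReal.ofReal (Real.exp (∑ i, w⁻¹ * ∫ r in (0 : ℝ)..w, qm m (Φ.flow r z i))) ∂P ≤ B) :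
    ∫⁻ z, ENNReal.ofReal (Real.exp (β * ∑ i, w⁻¹ * ∫ r in (0 : ℝ)..w, q (Φ.flow r z i))) ∂P ≤ B := by
  refine lintegral_exp_le_of_eq_avg (X := fun m z => ∑ i, w⁻¹ * ∫ r in (0 : ℝ)..w, qm m (Φ.flow r z i))
    (fun m => aemeasurable_windowSum Φ hP (hqm m) w) ?_ hB
  filter_upwards [(mem_ae_iff.mpr hP : ∀ᵐ z ∂P, z ∈ Φ.good)] with z hz
  exact windowSum_split Φ hz q hqm β _ w hq

end Flow

/-! ## §5 The registered helper statement -/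

/-- Helper statement `WindowRankSplit` (helper stub of `stub_productKineticInstance`, line rare-band-ladder-dock,
file 2 of 3): the window exponential moment of `β · lo` is at most `B` as soon as `β · lo` is the average of
finitely many continuous one-body observables each of whose window exponential moments is at most `B`, for
every hard-sphere flow on `𝕋³` and every law carried by its good set — route-internal, not a cited fact. -/
def WindowRankSplit : Prop :=
  ∀ (n : ℕ) (ε : ℝ) (Φ : HardSphereFlow (Torus.geometry (Fin 3)) ε n) (P : Measure (Config n (Fin 3) T3)),
    P Φ.goodᶜ = 0 → ∀ (k : ℕ) (q : T3 × V3 → ℝ) (qm : Fin (k + 1) → T3 × V3 → ℝ),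
    (∀ m, Continuous (qm m)) → ∀ β : ℝ, (∀ y, β * q y = ((k : ℝ) + 1)⁻¹ * ∑ m, qm m y) →
    ∀ (w : ℝ) (B : ℝ≥0∞),
    (∀ m, ∫⁻ z, ENNReal.ofReal (Real.exp (∑ i, w⁻¹ * ∫ r in (0 : ℝ)..w, qm m (Φ.flow r z i))) ∂P ≤ B) →
    ∫⁻ z, ENNReal.ofReal (Real.exp (β * ∑ i, w⁻¹ * ∫ r in (0 : ℝ)..w, q (Φ.flow r z i))) ∂P ≤ B

/-- **Registered helper stub `stub_windowRankSplit`** (helper of `stub_productKineticInstance`, line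
rare-band-ladder-dock, file 2 of 3): `WindowRankSplit` holds (`lintegral_exp_window_avg_le` over `Fin (k+1)`).
[folklore] -/
theorem stub_windowRankSplit : WindowRankSplit := by
  intro n ε Φ P hP k q qm hqm β hq w B hB
  refine lintegral_exp_window_avg_le Φ hP q hqm β (fun y => ?_) w hB
  rw [hq y, Fintype.card_fin, Nat.cast_add, Nat.cast_one]

end Summit.AtomisticToContinuum.HydrodynamicLimit.Theorems.KineticWindowGronwallProductKineticInstance

end
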